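import Summits.Ventures.CertifiedManyBodySolver.Observables.PairLROTowerChargedReadingTwistedFlipAux
import HarnessLib

/-!
# OP1-C, part 16: SIGN-SPLIT ASSEMBLY of the auxiliary nodes `hauxp` / `hauxm` from per-generator two-sided
# one-point nodes (node-file tool, TIGHT form)

HONEST FRAMING: first certified bounds on pairing observables; not a superconductivity verdict; a ceiling route,
never presence; nothing in this file is a number. Crew hubbard-obs (D-0042), seat hubbard-obs-p1
(`prover-hubbard-obs-p1-g10-0`); lead RULING (fr) d210 («(ex2) GO», 2026-08-27). Zero compute; no definition; no
named fact; no `sorry`.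

The cells consumer `ObsPairLROCeilingAt_of_onePoint_charged_twistedFlip_orbitState_gridCells_bound_sq_aux`
(PairLROTowerChargedReadingTwistedFlipAux) wants, per cell, two flip-twisted one-point nodes `hauxp` / `hauxm` on
`∓Re ω̄^{twf}_ζ(N̂ Γ_L X − Γ_L X N̂)` for the cell's eom word `X = Σ_i λ_i • W_i` (`W_i` ladder words of charge `q_i`,
real `λ_i`). The producer (sr-mbsolver-menu-3, kit j261965 / j266080) certifies instead, once for all cells, TWO-SIDED
one-point bounds on `Re ω(W_i)` per generator word. Since `N̂X − XN̂ = Σ_i (λ_i q_i) • W_i`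
(`totalNumberOp_commutator_sum_smul_ladderWord`), the auxiliary nodes are nonnegative combinations of the per-word
nodes, lower or upper according to the sign of `∓λ_i q_i`:

* **`twistedFlip_onePoint_node_signSplit`** — two-sided nodes for words `Y_i` and nonnegative splits `a⁺_i, a⁻_i` give
  the node for `Σ_i (a⁺_i − a⁻_i) • Y_i` with constants `Σ_i (a⁺_i c^lo_i + a⁻_i c^up_i)`, … (`twistedFlip_onePoint_node_smul`
  on `a⁺_i • Y_i` and `a⁻_i • (−Y_i)`, then the sum);
* **`twistedFlip_hauxp_of_twoSided` / `twistedFlip_hauxm_of_twoSided`** — the two auxiliary nodes of the cells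
  consumer for `X = Σ_i λ_i • ladderWord (l i)`, from per-word two-sided nodes and splits `a⁺_i − a⁻_i = −λ_i q_i`
  resp. `b⁺_i − b⁻_i = +λ_i q_i` (literals the node file checks by `norm_num`);
* §3 (append): **`ObsPairLROCeilingAt_of_onePoint_charged_twistedFlip_orbitState_gridCells_bound_sq_aux_reprice`** — the
  FAST LAYER of the certified-B cell leaf: the same main and auxiliary nodes re-priced under any later certified cap
  `e₀ ≤ hi` (constants shifted by `κ_j(u_j − hi)`, `k^±_j(u_j − hi)`; zero new solves);
* §4 (append): **`ObsPairLROCeilingAt_of_onePoint_charged_twistedFlip_orbitState_near_of_cover_aux`** — the envelope over an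
  ARBITRARY family of cells covering the bracket (cells from several certificate jobs; refinements / overlaps allowed).

References: T. Koma, H. Tasaki, J. Stat. Phys. 76 (1994) 745, Theorem 5 [KomaTasaki1994]; O. Bratteli,
D. W. Robinson, *Operator Algebras and Quantum Statistical Mechanics 2* (1997) §5.2.2, §6.2.4 [BratteliRobinsonII1997].
-/

noncomputable section

namespace Summit.Ventures.CertifiedManyBodySolver.Observables

open Matrix Complex Finset Literature.MathematicalPhysics.QuantumLattice Literature.Probability.LatticeModels
open Literature.MathematicalPhysics.QuantumLattice.HubbardWave0
open Literature.MathematicalPhysics.QuantumManyBody.StateRelaxation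
open scoped ComplexOrder ComplexConjugate BigOperators

/-! ### §2  Sign-split assembly of the auxiliary nodes from per-generator two-sided nodes -/

section Assembly

variable {L : ℕ} [NeZero L] {Λ' : Finset (Site 2)}

/-- **Sign-split assembly.** Two-sided flip-twisted one-point nodes for words `Y_i` — a LOWER node
`c^lo_i − A^lo_i + m^lo_i(fill) + k^lo_i(u − e) ≤ Re ω̄^{twf}_ζ(Γ_L Y_i)` and an UPPER node
`c^up_i − A^up_i + m^up_i(fill) + k^up_i(u − e) ≤ −Re ω̄^{twf}_ζ(Γ_L Y_i)` — and nonnegative splits `a⁺_i, a⁻_i` give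
the node for `Σ_i (a⁺_i − a⁻_i) • Y_i` with constants `Σ_i (a⁺_i c^lo_i + a⁻_i c^up_i)`, …
(`twistedFlip_onePoint_node_smul` on `a⁺_i • Y_i` and `a⁻_i • (−Y_i)`, then `twistedFlip_onePoint_node_sum`).
[cite: KomaTasaki1994, Theorem 5] [cite: BratteliRobinsonII1997, §6.2.4] -/
theorem twistedFlip_onePoint_node_signSplit {κι : Type*} (s : Finset κι) (S : Finset (DihedralGroup 4))
    (t t' U u ν₀ : ℝ) (cL AL mL kL cU AU mU kU ap am : κι → ℝ) (Y : κι → FermionOp Λ')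
    (h : Set.InjOn (Torus.proj (d := 2) L) ↑Λ') (ζ : Fock (Orb (FermionTorus 2 L)))
    (hap : ∀ i ∈ s, 0 ≤ ap i) (ham : ∀ i ∈ s, 0 ≤ am i)
    (hlo : ∀ i ∈ s,
      cL i - AL i + mL i * ((star ζ ⬝ᵥ ((totalNumber : Matrix (Finset (Orb (FermionTorus 2 L))) _ ℂ) *ᵥ ζ)).re /
          (L : ℝ) ^ 2 - ν₀) +
        kL i * (u - (star ζ ⬝ᵥ (hubbardTorusTT' L t t' U *ᵥ ζ)).re / (L : ℝ) ^ 2) ≤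
        (orbitState (twistedFlipSpaceGroupUnitary S) ζ (fermionEmbed (PolySite.toTorusEmb L h) (Y i))).re)
    (hup : ∀ i ∈ s,
      cU i - AU i + mU i * ((star ζ ⬝ᵥ ((totalNumber : Matrix (Finset (Orb (FermionTorus 2 L))) _ ℂ) *ᵥ ζ)).re /
          (L : ℝ) ^ 2 - ν₀) +
        kU i * (u - (star ζ ⬝ᵥ (hubbardTorusTT' L t t' U *ᵥ ζ)).re / (L : ℝ) ^ 2) ≤
        -(orbitState (twistedFlipSpaceGroupUnitary S) ζ (fermionEmbed (PolySite.toTorusEmb L h) (Y i))).re) :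
    (∑ i ∈ s, (ap i * cL i + am i * cU i)) - (∑ i ∈ s, (ap i * AL i + am i * AU i)) +
        (∑ i ∈ s, (ap i * mL i + am i * mU i)) *
          ((star ζ ⬝ᵥ ((totalNumber : Matrix (Finset (Orb (FermionTorus 2 L))) _ ℂ) *ᵥ ζ)).re / (L : ℝ) ^ 2 - ν₀) +
        (∑ i ∈ s, (ap i * kL i + am i * kU i)) * (u - (star ζ ⬝ᵥ (hubbardTorusTT' L t t' U *ᵥ ζ)).re / (L : ℝ) ^ 2) ≤
      (orbitState (twistedFlipSpaceGroupUnitary S) ζ (fermionEmbed (PolySite.toTorusEmb L h)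
        (∑ i ∈ s, (((ap i - am i : ℝ)) : ℂ) • Y i))).re := by
  -- per index: the node for `(a⁺ − a⁻) • Y = a⁺ • Y + a⁻ • (−Y)`
  have hi : ∀ i ∈ s,
      (ap i * cL i + am i * cU i) - (ap i * AL i + am i * AU i) +
          (ap i * mL i + am i * mU i) *
            ((star ζ ⬝ᵥ ((totalNumber : Matrix (Finset (Orb (FermionTorus 2 L))) _ ℂ) *ᵥ ζ)).re / (L : ℝ) ^ 2 - ν₀) +
          (ap i * kL i + am i * kU i) * (u - (star ζ ⬝ᵥ (hubbardTorusTT' L t t' U *ᵥ ζ)).re / (L : ℝ) ^ 2) ≤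
        (orbitState (twistedFlipSpaceGroupUnitary S) ζ (fermionEmbed (PolySite.toTorusEmb L h)
          ((((ap i - am i : ℝ)) : ℂ) • Y i))).re := by
    intro i his
    have hp := twistedFlip_onePoint_node_smul S t t' U u ν₀ (hap i his) (Y i) h ζ (hlo i his)
    have hupneg : cU i - AU i + mU i *
          ((star ζ ⬝ᵥ ((totalNumber : Matrix (Finset (Orb (FermionTorus 2 L))) _ ℂ) *ᵥ ζ)).re / (L : ℝ) ^ 2 - ν₀) +
        kU i * (u - (star ζ ⬝ᵥ (hubbardTorusTT' L t t' U *ᵥ ζ)).re / (L : ℝ) ^ 2) ≤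
        (orbitState (twistedFlipSpaceGroupUnitary S) ζ (fermionEmbed (PolySite.toTorusEmb L h) (-Y i))).re := by
      rw [fermionEmbed_neg, map_neg, Complex.neg_re]
      exact hup i his
    have hm := twistedFlip_onePoint_node_smul S t t' U u ν₀ (ham i his) (-Y i) h ζ hupneg
    have hsum : (((ap i - am i : ℝ)) : ℂ) • Y i = ((ap i : ℝ) : ℂ) • Y i + ((am i : ℝ) : ℂ) • (-Y i) := by
      rw [smul_neg, ← sub_eq_add_neg, ← sub_smul, ← Complex.ofReal_sub]
    rw [hsum, fermionEmbed_add, map_add, Complex.add_re]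
    linarith [hp, hm]
  have hL : (∑ i ∈ s, (ap i * cL i + am i * cU i)) - (∑ i ∈ s, (ap i * AL i + am i * AU i)) +
        (∑ i ∈ s, (ap i * mL i + am i * mU i)) *
          ((star ζ ⬝ᵥ ((totalNumber : Matrix (Finset (Orb (FermionTorus 2 L))) _ ℂ) *ᵥ ζ)).re / (L : ℝ) ^ 2 - ν₀) +
        (∑ i ∈ s, (ap i * kL i + am i * kU i)) * (u - (star ζ ⬝ᵥ (hubbardTorusTT' L t t' U *ᵥ ζ)).re / (L : ℝ) ^ 2) =
      ∑ i ∈ s, ((ap i * cL i + am i * cU i) - (ap i * AL i + am i * AU i) +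
          (ap i * mL i + am i * mU i) *
            ((star ζ ⬝ᵥ ((totalNumber : Matrix (Finset (Orb (FermionTorus 2 L))) _ ℂ) *ᵥ ζ)).re / (L : ℝ) ^ 2 - ν₀) +
          (ap i * kL i + am i * kU i) * (u - (star ζ ⬝ᵥ (hubbardTorusTT' L t t' U *ᵥ ζ)).re / (L : ℝ) ^ 2)) := by
    simp only [Finset.sum_add_distrib, Finset.sum_sub_distrib, Finset.sum_mul, add_mul]
  rw [hL, fermionEmbed_sum, map_sum, Complex.re_sum]
  exact Finset.sum_le_sum hi

/-- **`hauxp` from per-word two-sided nodes.** For the cell's eom word `X = Σ_i λ_i • ladderWord (l i)` (real `λ_i`),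
two-sided flip-twisted one-point nodes on each `ladderWord (l i)`, and a nonnegative split `a⁺_i − a⁻_i = −λ_i·q(l i)`
of the coefficients of `−(N̂X − XN̂) = Σ_i (−λ_i q_i) • W_i` (`totalNumberOp_commutator_sum_smul_ladderWord`), the summed
data form the sense-`+` auxiliary node of `…_gridCells_bound_sq_aux`:
`c₊ − A₊ + μ₊(fill) + k₊(u − e) ≤ −Re ω̄^{twf}_ζ(N̂ Γ_L X − Γ_L X N̂)`. [cite: KomaTasaki1994, Theorem 5]
[cite: BratteliRobinsonII1997, §5.2.2] -/
theorem twistedFlip_hauxp_of_twoSided {κι : Type*} (s : Finset κι) (S : Finset (DihedralGroup 4))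
    (t t' U u ν₀ : ℝ) (lam : κι → ℝ) (l : κι → List (Orb (PolySite Λ') × Bool))
    (cL AL mL kL cU AU mU kU ap am : κι → ℝ)
    (h : Set.InjOn (Torus.proj (d := 2) L) ↑Λ') (ζ : Fock (Orb (FermionTorus 2 L)))
    (hap : ∀ i ∈ s, 0 ≤ ap i) (ham : ∀ i ∈ s, 0 ≤ am i)
    (hsplit : ∀ i ∈ s, ap i - am i = -(lam i * (ladderCharge (l i) : ℝ)))
    (hlo : ∀ i ∈ s,
      cL i - AL i + mL i * ((star ζ ⬝ᵥ ((totalNumber : Matrix (Finset (Orb (FermionTorus 2 L))) _ ℂ) *ᵥ ζ)).re /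
          (L : ℝ) ^ 2 - ν₀) +
        kL i * (u - (star ζ ⬝ᵥ (hubbardTorusTT' L t t' U *ᵥ ζ)).re / (L : ℝ) ^ 2) ≤
        (orbitState (twistedFlipSpaceGroupUnitary S) ζ
          (fermionEmbed (PolySite.toTorusEmb L h) (ladderWord (l i)))).re)
    (hup : ∀ i ∈ s,
      cU i - AU i + mU i * ((star ζ ⬝ᵥ ((totalNumber : Matrix (Finset (Orb (FermionTorus 2 L))) _ ℂ) *ᵥ ζ)).re /
          (L : ℝ) ^ 2 - ν₀) +
        kU i * (u - (star ζ ⬝ᵥ (hubbardTorusTT' L t t' U *ᵥ ζ)).re / (L : ℝ) ^ 2) ≤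
        -(orbitState (twistedFlipSpaceGroupUnitary S) ζ
          (fermionEmbed (PolySite.toTorusEmb L h) (ladderWord (l i)))).re) :
    (∑ i ∈ s, (ap i * cL i + am i * cU i)) - (∑ i ∈ s, (ap i * AL i + am i * AU i)) +
        (∑ i ∈ s, (ap i * mL i + am i * mU i)) *
          ((star ζ ⬝ᵥ ((totalNumber : Matrix (Finset (Orb (FermionTorus 2 L))) _ ℂ) *ᵥ ζ)).re / (L : ℝ) ^ 2 - ν₀) +
        (∑ i ∈ s, (ap i * kL i + am i * kU i)) * (u - (star ζ ⬝ᵥ (hubbardTorusTT' L t t' U *ᵥ ζ)).re / (L : ℝ) ^ 2) ≤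
      -(orbitState (twistedFlipSpaceGroupUnitary S) ζ
        ((totalNumber : Matrix (Finset (Orb (FermionTorus 2 L))) _ ℂ) *
            fermionEmbed (PolySite.toTorusEmb L h) (∑ i ∈ s, ((lam i : ℝ) : ℂ) • (ladderWord (l i) : FermionOp Λ')) -
          fermionEmbed (PolySite.toTorusEmb L h) (∑ i ∈ s, ((lam i : ℝ) : ℂ) • (ladderWord (l i) : FermionOp Λ')) *
            totalNumber)).re := by
  have hX : (∑ i ∈ s, (((ap i - am i : ℝ)) : ℂ) • (ladderWord (l i) : FermionOp Λ')) =
      -((totalNumberOp : FermionOp Λ') * (∑ i ∈ s, ((lam i : ℝ) : ℂ) • (ladderWord (l i) : FermionOp Λ')) -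
        (∑ i ∈ s, ((lam i : ℝ) : ℂ) • (ladderWord (l i) : FermionOp Λ')) * totalNumberOp) := by
    rw [totalNumberOp_commutator_sum_smul_ladderWord, ← Finset.sum_neg_distrib]
    refine Finset.sum_congr rfl fun i his => ?_
    rw [← neg_smul]
    congr 1
    have hs := hsplit i his
    have hc : (((ap i - am i : ℝ)) : ℂ) = ((-(lam i * (ladderCharge (l i) : ℝ)) : ℝ) : ℂ) := by rw [hs]
    rw [hc]
    push_cast
    ring
  have hnode := twistedFlip_onePoint_node_signSplit s S t t' U u ν₀ cL AL mL kL cU AU mU kU ap am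
    (fun i => (ladderWord (l i) : FermionOp Λ')) h ζ hap ham hlo hup
  rw [re_orbitState_totalNumber_commutator_fermionEmbed]
  rw [hX, fermionEmbed_neg, map_neg, Complex.neg_re] at hnode
  exact hnode

/-- **`hauxm` from per-word two-sided nodes**: as `twistedFlip_hauxp_of_twoSided` with the split
`b⁺_i − b⁻_i = +λ_i·q(l i)`; conclusion `c₋ − A₋ + μ₋(fill) + k₋(u − e) ≤ +Re ω̄^{twf}_ζ(N̂ Γ_L X − Γ_L X N̂)`.
[cite: KomaTasaki1994, Theorem 5] [cite: BratteliRobinsonII1997, §5.2.2] -/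
theorem twistedFlip_hauxm_of_twoSided {κι : Type*} (s : Finset κι) (S : Finset (DihedralGroup 4))
    (t t' U u ν₀ : ℝ) (lam : κι → ℝ) (l : κι → List (Orb (PolySite Λ') × Bool))
    (cL AL mL kL cU AU mU kU bp bm : κι → ℝ)
    (h : Set.InjOn (Torus.proj (d := 2) L) ↑Λ') (ζ : Fock (Orb (FermionTorus 2 L)))
    (hbp : ∀ i ∈ s, 0 ≤ bp i) (hbm : ∀ i ∈ s, 0 ≤ bm i)
    (hsplit : ∀ i ∈ s, bp i - bm i = lam i * (ladderCharge (l i) : ℝ))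
    (hlo : ∀ i ∈ s,
      cL i - AL i + mL i * ((star ζ ⬝ᵥ ((totalNumber : Matrix (Finset (Orb (FermionTorus 2 L))) _ ℂ) *ᵥ ζ)).re /
          (L : ℝ) ^ 2 - ν₀) +
        kL i * (u - (star ζ ⬝ᵥ (hubbardTorusTT' L t t' U *ᵥ ζ)).re / (L : ℝ) ^ 2) ≤
        (orbitState (twistedFlipSpaceGroupUnitary S) ζ
          (fermionEmbed (PolySite.toTorusEmb L h) (ladderWord (l i)))).re)
    (hup : ∀ i ∈ s,
      cU i - AU i + mU i * ((star ζ ⬝ᵥ ((totalNumber : Matrix (Finset (Orb (FermionTorus 2 L))) _ ℂ) *ᵥ ζ)).re /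
          (L : ℝ) ^ 2 - ν₀) +
        kU i * (u - (star ζ ⬝ᵥ (hubbardTorusTT' L t t' U *ᵥ ζ)).re / (L : ℝ) ^ 2) ≤
        -(orbitState (twistedFlipSpaceGroupUnitary S) ζ
          (fermionEmbed (PolySite.toTorusEmb L h) (ladderWord (l i)))).re) :
    (∑ i ∈ s, (bp i * cL i + bm i * cU i)) - (∑ i ∈ s, (bp i * AL i + bm i * AU i)) +
        (∑ i ∈ s, (bp i * mL i + bm i * mU i)) *
          ((star ζ ⬝ᵥ ((totalNumber : Matrix (Finset (Orb (FermionTorus 2 L))) _ ℂ) *ᵥ ζ)).re / (L : ℝ) ^ 2 - ν₀) +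
        (∑ i ∈ s, (bp i * kL i + bm i * kU i)) * (u - (star ζ ⬝ᵥ (hubbardTorusTT' L t t' U *ᵥ ζ)).re / (L : ℝ) ^ 2) ≤
      (orbitState (twistedFlipSpaceGroupUnitary S) ζ
        ((totalNumber : Matrix (Finset (Orb (FermionTorus 2 L))) _ ℂ) *
            fermionEmbed (PolySite.toTorusEmb L h) (∑ i ∈ s, ((lam i : ℝ) : ℂ) • (ladderWord (l i) : FermionOp Λ')) -
          fermionEmbed (PolySite.toTorusEmb L h) (∑ i ∈ s, ((lam i : ℝ) : ℂ) • (ladderWord (l i) : FermionOp Λ')) *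
            totalNumber)).re := by
  have hX : (∑ i ∈ s, (((bp i - bm i : ℝ)) : ℂ) • (ladderWord (l i) : FermionOp Λ')) =
      (totalNumberOp : FermionOp Λ') * (∑ i ∈ s, ((lam i : ℝ) : ℂ) • (ladderWord (l i) : FermionOp Λ')) -
        (∑ i ∈ s, ((lam i : ℝ) : ℂ) • (ladderWord (l i) : FermionOp Λ')) * totalNumberOp := by
    rw [totalNumberOp_commutator_sum_smul_ladderWord]
    refine Finset.sum_congr rfl fun i his => ?_
    congr 1
    have hs := hsplit i his
    have hc : (((bp i - bm i : ℝ)) : ℂ) = (((lam i * (ladderCharge (l i) : ℝ)) : ℝ) : ℂ) := by rw [hs]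
    rw [hc]
    push_cast
    ring
  have hnode := twistedFlip_onePoint_node_signSplit s S t t' U u ν₀ cL AL mL kL cU AU mU kU bp bm
    (fun i => (ladderWord (l i) : FermionOp Λ')) h ζ hbp hbm hlo hup
  rw [re_orbitState_totalNumber_commutator_fermionEmbed]
  rw [hX] at hnode
  exact hnode

end Assembly

/-! ### §3 (append, p1 g10 ≥ 04:00Z) THE FAST LAYER for certified-B cell leaves: re-pricing every cell under a later cap -/

section Reprice

open ThermodynamicLimit Summit.Ventures.CertifiedManyBodySolver.Transport

variable {tp U n : ℝ} {hi c' : ℚ}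

/-- **FLIP-TWISTED OP1-C CELL LEAF, TIGHT FORM, RE-PRICED under ANY certified cap `e₀ ≤ hi`** (the one-point fast
layer at the cell level for the certified-B form): the same per-cell main nodes (caps `u_j`, energy multipliers
`κ_j ≥ 0`) AND auxiliary nodes (same caps `u_j`, energy multipliers `kp_j, km_j ≥ 0`) give `ObsPairLROCeilingAt t′ U n c′`
at every `c′` dominating, for every cell, the three squares with the constants shifted by `κ_j(u_j − hi)`,
`kp_j(u_j − hi)`, `km_j(u_j − hi)` — zero new solves when the energy cap improves.
[cite: KomaTasaki1994, Theorem 5] [cite: BratteliRobinsonII1997, §6.2.4] -/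
theorem ObsPairLROCeilingAt_of_onePoint_charged_twistedFlip_orbitState_gridCells_bound_sq_aux_reprice (hU : 0 ≤ U)
    (hn0 : 0 < n) (hn2 : n < 2) (hE : energyDensityTT' 1 tp U n ≤ ((hi : ℚ) : ℝ)) {J : ℕ} (m : Fin (J + 2) → ℝ)
    (hm : Monotone m) (hlo : m 0 ≤ chemPotMinusTT' 1 tp U n) (hhi' : chemPotPlusTT' 1 tp U n ≤ m (Fin.last (J + 1)))
    (μ' Δ : Fin (J + 1) → ℝ) (hleft : ∀ j, μ' j - Δ j ≤ m j.castSucc) (hright : ∀ j, m j.succ ≤ μ' j + Δ j)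
    (c A κ u μ₀ ν₀ : Fin (J + 1) → ℝ) (hκ : ∀ j, 0 ≤ κ j)
    (cp Ap kp μp cm Am km μm : Fin (J + 1) → ℝ) (hkp : ∀ j, 0 ≤ kp j) (hkm : ∀ j, 0 ≤ km j)
    {S : Finset (DihedralGroup 4)} (hS : S.Nonempty)
    {Λ' : Finset (Site 2)} (h0 : pairRegion (insert (0 : Site 2) unitSteps) 0 ⊆ Λ')
    (X : Fin (J + 1) → FermionOp Λ')
    (hXeven : ∀ j, X j ∈ carEvenSubalgebra (Finset.univ : Finset (Orb (PolySite Λ'))))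
    (hXevenH : ∀ j, (X j)ᴴ ∈ carEvenSubalgebra (Finset.univ : Finset (Orb (PolySite Λ')))) (L₁ : ℕ)
    (hInj : ∀ L : ℕ, L₁ ≤ L → Set.InjOn (Torus.proj (d := 2) L) ↑Λ')
    (hauxp : ∀ j, ∀ (L : ℕ) [NeZero L] (hL : L₁ ≤ L) (ζ : Fock (Orb (FermionTorus 2 L))), star ζ ⬝ᵥ ζ = 1 →
      cp j - Ap j + μp j * ((star ζ ⬝ᵥ ((totalNumber : Matrix (Finset (Orb (FermionTorus 2 L))) _ ℂ) *ᵥ ζ)).re /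
          (L : ℝ) ^ 2 - ν₀ j) +
        kp j * (u j - (star ζ ⬝ᵥ (hubbardTorusTT' L 1 tp U *ᵥ ζ)).re / (L : ℝ) ^ 2) ≤
        -(orbitState (twistedFlipSpaceGroupUnitary S) ζ
          ((totalNumber : Matrix (Finset (Orb (FermionTorus 2 L))) _ ℂ) *
              fermionEmbed (PolySite.toTorusEmb L (hInj L hL)) (X j) -
            fermionEmbed (PolySite.toTorusEmb L (hInj L hL)) (X j) * totalNumber)).re)
    (hauxm : ∀ j, ∀ (L : ℕ) [NeZero L] (hL : L₁ ≤ L) (ζ : Fock (Orb (FermionTorus 2 L))), star ζ ⬝ᵥ ζ = 1 →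
      cm j - Am j + μm j * ((star ζ ⬝ᵥ ((totalNumber : Matrix (Finset (Orb (FermionTorus 2 L))) _ ℂ) *ᵥ ζ)).re /
          (L : ℝ) ^ 2 - ν₀ j) +
        km j * (u j - (star ζ ⬝ᵥ (hubbardTorusTT' L 1 tp U *ᵥ ζ)).re / (L : ℝ) ^ 2) ≤
        (orbitState (twistedFlipSpaceGroupUnitary S) ζ
          ((totalNumber : Matrix (Finset (Orb (FermionTorus 2 L))) _ ℂ) *
              fermionEmbed (PolySite.toTorusEmb L (hInj L hL)) (X j) -
            fermionEmbed (PolySite.toTorusEmb L (hInj L hL)) (X j) * totalNumber)).re)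
    (hbound : ∀ j, ∀ (L : ℕ) [NeZero L] (hL : L₁ ≤ L) (ζ : Fock (Orb (FermionTorus 2 L))), star ζ ⬝ᵥ ζ = 1 →
      c j - A j + μ₀ j * ((star ζ ⬝ᵥ ((totalNumber : Matrix (Finset (Orb (FermionTorus 2 L))) _ ℂ) *ᵥ ζ)).re /
          (L : ℝ) ^ 2 - ν₀ j) +
        κ j * (u j - (star ζ ⬝ᵥ (hubbardTorusTT' L 1 tp U *ᵥ ζ)).re / (L : ℝ) ^ 2) +
        (orbitState (twistedFlipSpaceGroupUnitary S) ζ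
          ((hubbardTorusTT' L 1 tp U - (μ' j : ℂ) • totalNumber) * fermionEmbed (PolySite.toTorusEmb L (hInj L hL)) (X j) -
            fermionEmbed (PolySite.toTorusEmb L (hInj L hL)) (X j) *
              (hubbardTorusTT' L 1 tp U - (μ' j : ℂ) • totalNumber))).re ≤
        (orbitState (twistedFlipSpaceGroupUnitary S) ζ (fermionEmbed (PolySite.toTorusEmb L (hInj L hL))
          (-(fermionEmbed (PolySite.incl h0)
            (localPairAt (insert (0 : Site 2) unitSteps) dWaveFormFactor 0))))).re)
    (hc0 : ∀ j, (c j + κ j * (u j - ((hi : ℚ) : ℝ)) - A j + μ₀ j * (n - ν₀ j)) ^ 2 ≤ ((c' : ℚ) : ℝ))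
    (hcp : ∀ j, (c j + κ j * (u j - ((hi : ℚ) : ℝ)) + Δ j * (cp j + kp j * (u j - ((hi : ℚ) : ℝ)) - Ap j) - A j +
      (μ₀ j + Δ j * μp j) * (n - ν₀ j)) ^ 2 ≤ ((c' : ℚ) : ℝ))
    (hcm : ∀ j, (c j + κ j * (u j - ((hi : ℚ) : ℝ)) + Δ j * (cm j + km j * (u j - ((hi : ℚ) : ℝ)) - Am j) - A j +
      (μ₀ j + Δ j * μm j) * (n - ν₀ j)) ^ 2 ≤ ((c' : ℚ) : ℝ)) :
    ObsPairLROCeilingAt tp U n c' := by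
  refine ObsPairLROCeilingAt_of_onePoint_charged_twistedFlip_orbitState_gridCells_bound_sq_aux hU hn0 hn2 hE m hm hlo
    hhi' μ' Δ hleft hright (fun j => c j + κ j * (u j - ((hi : ℚ) : ℝ))) A κ (fun _ => ((hi : ℚ) : ℝ)) μ₀ ν₀ hκ
    (fun _ => le_rfl) (fun j => cp j + kp j * (u j - ((hi : ℚ) : ℝ))) Ap kp μp
    (fun j => cm j + km j * (u j - ((hi : ℚ) : ℝ))) Am km μm hkp hkm hS h0 X hXeven hXevenH L₁ hInj ?_ ?_ ?_
    hc0 hcp hcm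
  · intro j L _ hL ζ hζ
    convert hauxp j L hL ζ hζ using 1
    ring
  · intro j L _ hL ζ hζ
    convert hauxm j L hL ζ hζ using 1
    ring
  · intro j L _ hL ζ hζ
    convert hbound j L hL ζ hζ using 1
    ring

end Reprice

/-! ### §4 (append, p1 g10 ≥ 05:35Z) ENVELOPE over an ARBITRARY cover (cells from several jobs, overlaps allowed) — tight form -/

section Cover

open ThermodynamicLimit Summit.Ventures.CertifiedManyBodySolver.Transport

variable {tp U n : ℝ} {hi c' : ℚ}

/-- **FLIP-TWISTED OP1-C ENVELOPE over a cover, TIGHT FORM**: as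
`ObsPairLROCeilingAt_of_onePoint_charged_twistedFlip_orbitState_near_of_cover` (PairLROTowerChargedLeafCellsTwisted) —
ANY family of cells `[μ′_i − Δ_i, μ′_i + Δ_i]` whose union contains a bracket `[μ_lo, μ_hi] ⊇ [μ₋(n), μ₊(n)]` (cells from
different certificate jobs, refinements and overlaps allowed) — with the operator-norm charge bound replaced by the two
auxiliary one-point nodes of each cell (`hauxp i`, `hauxm i`): `ObsPairLROCeilingAt t′ U n c′` at every rational `c′`
dominating, for every cell, the three squares at `s = 0, ±Δ_i`. [cite: KomaTasaki1994, Theorem 5] [cite: BratteliRobinsonII1997, §6.2.4] -/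
theorem ObsPairLROCeilingAt_of_onePoint_charged_twistedFlip_orbitState_near_of_cover_aux (hU : 0 ≤ U) (hn0 : 0 < n)
    (hn2 : n < 2) (hE : energyDensityTT' 1 tp U n ≤ ((hi : ℚ) : ℝ)) {μlo μhi : ℝ}
    (hlo : μlo ≤ chemPotMinusTT' 1 tp U n) (hhi' : chemPotPlusTT' 1 tp U n ≤ μhi)
    {ι : Type*} (μ' Δ : ι → ℝ) (hcover : Set.Icc μlo μhi ⊆ ⋃ i, Set.Icc (μ' i - Δ i) (μ' i + Δ i))
    (c A κ u μ₀ ν₀ : ι → ℝ) (hκ : ∀ i, 0 ≤ κ i) (hhi : ∀ i, ((hi : ℚ) : ℝ) ≤ u i)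
    (cp Ap kp μp cm Am km μm : ι → ℝ) (hkp : ∀ i, 0 ≤ kp i) (hkm : ∀ i, 0 ≤ km i)
    {S : Finset (DihedralGroup 4)} (hS : S.Nonempty)
    {Λ' : Finset (Site 2)} (h0 : pairRegion (insert (0 : Site 2) unitSteps) 0 ⊆ Λ')
    (X : ι → FermionOp Λ')
    (hXeven : ∀ i, X i ∈ carEvenSubalgebra (Finset.univ : Finset (Orb (PolySite Λ'))))
    (hXevenH : ∀ i, (X i)ᴴ ∈ carEvenSubalgebra (Finset.univ : Finset (Orb (PolySite Λ')))) (L₁ : ℕ)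
    (hInj : ∀ L : ℕ, L₁ ≤ L → Set.InjOn (Torus.proj (d := 2) L) ↑Λ')
    (hauxp : ∀ i, ∀ (L : ℕ) [NeZero L] (hL : L₁ ≤ L) (ζ : Fock (Orb (FermionTorus 2 L))), star ζ ⬝ᵥ ζ = 1 →
      cp i - Ap i + μp i * ((star ζ ⬝ᵥ ((totalNumber : Matrix (Finset (Orb (FermionTorus 2 L))) _ ℂ) *ᵥ ζ)).re /
          (L : ℝ) ^ 2 - ν₀ i) +
        kp i * (u i - (star ζ ⬝ᵥ (hubbardTorusTT' L 1 tp U *ᵥ ζ)).re / (L : ℝ) ^ 2) ≤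
        -(orbitState (twistedFlipSpaceGroupUnitary S) ζ
          ((totalNumber : Matrix (Finset (Orb (FermionTorus 2 L))) _ ℂ) *
              fermionEmbed (PolySite.toTorusEmb L (hInj L hL)) (X i) -
            fermionEmbed (PolySite.toTorusEmb L (hInj L hL)) (X i) * totalNumber)).re)
    (hauxm : ∀ i, ∀ (L : ℕ) [NeZero L] (hL : L₁ ≤ L) (ζ : Fock (Orb (FermionTorus 2 L))), star ζ ⬝ᵥ ζ = 1 →
      cm i - Am i + μm i * ((star ζ ⬝ᵥ ((totalNumber : Matrix (Finset (Orb (FermionTorus 2 L))) _ ℂ) *ᵥ ζ)).re /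
          (L : ℝ) ^ 2 - ν₀ i) +
        km i * (u i - (star ζ ⬝ᵥ (hubbardTorusTT' L 1 tp U *ᵥ ζ)).re / (L : ℝ) ^ 2) ≤
        (orbitState (twistedFlipSpaceGroupUnitary S) ζ
          ((totalNumber : Matrix (Finset (Orb (FermionTorus 2 L))) _ ℂ) *
              fermionEmbed (PolySite.toTorusEmb L (hInj L hL)) (X i) -
            fermionEmbed (PolySite.toTorusEmb L (hInj L hL)) (X i) * totalNumber)).re)
    (hbound : ∀ i, ∀ (L : ℕ) [NeZero L] (hL : L₁ ≤ L) (ζ : Fock (Orb (FermionTorus 2 L))), star ζ ⬝ᵥ ζ = 1 →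
      c i - A i + μ₀ i * ((star ζ ⬝ᵥ ((totalNumber : Matrix (Finset (Orb (FermionTorus 2 L))) _ ℂ) *ᵥ ζ)).re /
          (L : ℝ) ^ 2 - ν₀ i) +
        κ i * (u i - (star ζ ⬝ᵥ (hubbardTorusTT' L 1 tp U *ᵥ ζ)).re / (L : ℝ) ^ 2) +
        (orbitState (twistedFlipSpaceGroupUnitary S) ζ
          ((hubbardTorusTT' L 1 tp U - (μ' i : ℂ) • totalNumber) * fermionEmbed (PolySite.toTorusEmb L (hInj L hL)) (X i) -
            fermionEmbed (PolySite.toTorusEmb L (hInj L hL)) (X i) *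
              (hubbardTorusTT' L 1 tp U - (μ' i : ℂ) • totalNumber))).re ≤
        (orbitState (twistedFlipSpaceGroupUnitary S) ζ (fermionEmbed (PolySite.toTorusEmb L (hInj L hL))
          (-(fermionEmbed (PolySite.incl h0)
            (localPairAt (insert (0 : Site 2) unitSteps) dWaveFormFactor 0))))).re)
    (hc0 : ∀ i, (c i - A i + μ₀ i * (n - ν₀ i)) ^ 2 ≤ ((c' : ℚ) : ℝ))
    (hcp : ∀ i, (c i + Δ i * (cp i - Ap i) - A i + (μ₀ i + Δ i * μp i) * (n - ν₀ i)) ^ 2 ≤ ((c' : ℚ) : ℝ))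
    (hcm : ∀ i, (c i + Δ i * (cm i - Am i) - A i + (μ₀ i + Δ i * μm i) * (n - ν₀ i)) ^ 2 ≤ ((c' : ℚ) : ℝ)) :
    ObsPairLROCeilingAt tp U n c' := by
  have hmp := chemPotMinusTT'_le_chemPotPlusTT' 1 tp hU hn0 hn2
  obtain ⟨i, hi⟩ := Set.mem_iUnion.1 (hcover ⟨hlo, hmp.trans hhi'⟩)
  have hnear : |μ' i - chemPotMinusTT' 1 tp U n| ≤ Δ i :=
    abs_sub_le_iff.2 ⟨by linarith [hi.1], by linarith [hi.2]⟩
  intro ψ hψ hψ1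
  exact liminf_pairFieldLRO_le_sq_of_onePoint_chargedStationary_twistedFlip_orbitState_bound_TT'_near_aux 1 tp hU hn0
    hn2 (hκ i) (hE.trans (hhi i)) ⟨le_rfl, hmp⟩ hnear hS h0 (X i) (hXeven i) (hXevenH i) L₁ hInj (hkp i) (hkm i)
    (hauxp i) (hauxm i) (hbound i) ψ hψ hψ1 (hc0 i) (hcp i) (hcm i)

end Cover

end Summit.Ventures.CertifiedManyBodySolver.Observables

end
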